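import Mathlib
import Literature.Analysis.FluidPDE.BeltramiFlows
import Summits.NavierStokesRegularity.NavierStokesRegularity.Theorems.QuarterLogPincerLimitSilenceDefs
import Summits.NavierStokesRegularity.NavierStokesRegularity.Theorems.QuarterLogPincerSmoothSilenceDefs
import Summits.NavierStokesRegularity.NavierStokesRegularity.Theorems.TypeIQuantSubcubicExp.Negative.SilencingCostBurnout
import HarnessLib

/-!
# Sc″ `DriftStretchSilencingCost`: which clauses of the drift–stretch class are load-bearing — refuter lane ns-afl-r1

Supports crux stmt-NavierStokesRegularity-24077 (`QuarterLogPincer.TypeIQuantSubcubicExp`) via ns-idea-7's line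
`smooth_silence` (Sc″ `SmoothSilence.DriftStretchSilencingCost`, by name from the typer's port
`…Theorems.QuarterLogPincerSmoothSilenceDefs`).  The drift–stretch class `DriftStretchBox B γ σ` has four clauses:
(ω) `‖∇ʲω‖ ≤ Bσ^{-(j+2)}`, `j ≤ 5`; (v) `‖∇ʲv‖ ≤ Bσ^{-(j+1)}`, `j ≤ 4`; (m) the three `γ`-Hölder time moduli of
`v`; (e) the equation `∂ₛω = Δω + Dv·ω − Dω·v`.  Kernel-checked mutation results:

* `driftStretchSilencingCost_false_without_equation` — drop (e), keep (ω)(v)(m): FALSE.  Witness at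
  `B = γ = δ = Γ₂ = σ = 1`: `v = 0`, `ω(s,x) = (1 − s)·e₀` (constant in space) on `[0,1]`; every spatial bound
  holds, centre enstrophy `4π/3 ≥ 1` at `s = 0`, final enstrophy `0 < c` at `s = 1`.
* `driftStretchSilencingCost_false_without_higherVorticityBounds` — keep (v)(m)(e) and ONLY the `j = 0` bound
  `‖ω‖ ≤ Bσ⁻²` of (ω): FALSE.  Witness: the exact caloric shear mode `ω(s,x) = σ⁻²e^{−s}·abc 0 1 0 (x)`, `v = 0`
  (so (e) is the heat equation, which it solves), on `[0,σ²]` at the burn-out scale `σ² = 5K³/c + 1` of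
  `SilencingCostBurnout` (p709605): frequency `σ` in box units — exactly what the `j ≥ 1` bounds forbid.
* `driftStretchSilencingCostFlat_of_thickBoxSilencingCost` — conversely the `j ≥ 2` bounds of (ω), the `j ≥ 2`
  bounds of (v) and ALL the moduli (m) (hence `γ`) are NOT needed for the conclusion GIVEN Sc′: the flat class
  (`j ≤ 1` bounds on `ω` and `v` + (e)) already lies in Sc′'s inequality class with the same `B`
  (`‖Dv·ω − Dω·v‖ ≤ Bσ⁻²‖ω‖ + Bσ⁻¹‖Dω‖`), so `ThickBoxSilencingCost` implies the FLAT silencing cost, which implies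
  Sc″ (`driftStretchSilencingCost_of_flat`).  Reading: (m) and the high derivative bounds serve the COMPACTNESS
  route L♯2 (`SmoothLimitStep`), not the estimate.

HONEST FRAME: mutation bookkeeping on an NS-free stub four levels below the crux; nothing here bears on 24077's
truth, W7 or Navier–Stokes regularity (OPEN).  Refuter/instrument seat ns-afl-r1 g12, `--supports
stmt-NavierStokesRegularity-24077`, Negative lane (no Theses statement is asserted).
-/

set_option linter.dupNamespace false

namespace Summit.NavierStokesRegularity.NavierStokesRegularity.Theorems.TypeIQuantSubcubicExp.Negative.SmoothSilence

noncomputable section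

open MeasureTheory Set Metric Function
open scoped Laplacian ENNReal
open Literature.Analysis Literature.Analysis.FluidPDE
open Summit.NavierStokesRegularity.NavierStokesRegularity.Cruxes.TypeIQuantSubcubicExp.LimitSilence
  (ThickBoxSilencingCost)
open Summit.NavierStokesRegularity.NavierStokesRegularity.Cruxes.TypeIQuantSubcubicExp.SmoothSilence
  (DriftStretchBox DriftStretchSilencingCost)
open Summit.NavierStokesRegularity.NavierStokesRegularity.Theorems.TypeIQuantSubcubicExp.Negative.SilencingCost
  (norm_abc_shear lintegral_ball_of_norm_const exists_burnout_scale)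

/-! ## Small calculus facts -/

/-- Derivatives of a constant field: `‖∇ʲ(const c)‖ ≤ ‖c‖` (equality for `j = 0`, zero for `j ≥ 1`). -/
theorem norm_iteratedFDeriv_const_le (j : ℕ) (c : EuclideanSpace ℝ (Fin 3)) (x : EuclideanSpace ℝ (Fin 3)) :
    ‖iteratedFDeriv ℝ j (fun _ : EuclideanSpace ℝ (Fin 3) => c) x‖ ≤ ‖c‖ := by
  rcases Nat.eq_zero_or_pos j with rfl | hj
  · rw [norm_iteratedFDeriv_zero]
  · rw [iteratedFDeriv_const_of_ne (Nat.pos_iff_ne_zero.1 hj)]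
    simp

/-- The zero coefficient satisfies clauses (v) and (m) of the drift–stretch class for any `B ≥ 0`, `σ > 0`. -/
theorem zero_coefficient_clauses {B γ σ : ℝ} (hB : 0 ≤ B) (hσ : 0 < σ) (S : Set ℝ) (s : ℝ)
    (x : EuclideanSpace ℝ (Fin 3)) :
    (∀ j : ℕ, j ≤ 4 → ‖iteratedFDeriv ℝ j ((fun (_ : ℝ) (_ : EuclideanSpace ℝ (Fin 3)) =>
        (0 : EuclideanSpace ℝ (Fin 3))) s) x‖ ≤ B * σ ^ (-((j : ℝ) + 1))) ∧
    (∀ s' ∈ S, ‖(fun (_ : ℝ) (_ : EuclideanSpace ℝ (Fin 3)) => (0 : EuclideanSpace ℝ (Fin 3))) s x -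
          (fun (_ : ℝ) (_ : EuclideanSpace ℝ (Fin 3)) => (0 : EuclideanSpace ℝ (Fin 3))) s' x‖ ≤
        B * σ ^ (-(1 : ℝ)) * (|s - s'| / σ ^ 2) ^ γ ∧
      ‖fderiv ℝ ((fun (_ : ℝ) (_ : EuclideanSpace ℝ (Fin 3)) => (0 : EuclideanSpace ℝ (Fin 3))) s) x -
          fderiv ℝ ((fun (_ : ℝ) (_ : EuclideanSpace ℝ (Fin 3)) => (0 : EuclideanSpace ℝ (Fin 3))) s') x‖ ≤
        B * σ ^ (-(2 : ℝ)) * (|s - s'| / σ ^ 2) ^ γ ∧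
      ‖iteratedFDeriv ℝ 2 ((fun (_ : ℝ) (_ : EuclideanSpace ℝ (Fin 3)) => (0 : EuclideanSpace ℝ (Fin 3))) s) x -
          iteratedFDeriv ℝ 2 ((fun (_ : ℝ) (_ : EuclideanSpace ℝ (Fin 3)) =>
            (0 : EuclideanSpace ℝ (Fin 3))) s') x‖ ≤
        B * σ ^ (-(3 : ℝ)) * (|s - s'| / σ ^ 2) ^ γ) := by
  refine ⟨fun j _ => ?_, fun s' _ => ⟨?_, ?_, ?_⟩⟩
  · exact (norm_iteratedFDeriv_const_le j 0 x).trans (by rw [norm_zero]; positivity)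
  · rw [sub_self, norm_zero]; positivity
  · rw [sub_self, norm_zero]; positivity
  · rw [sub_self, norm_zero]; positivity

/-! ## (e) The equation is load-bearing -/

/-- **Sc″ needs the equation.**  With clause (e) deleted from the drift–stretch class the silencing cost fails:
`v = 0`, `ω(s,x) = (1 − s)·e₀` on `[0,1] × ℝ³` at `B = γ = δ = Γ₂ = σ = 1`. [folklore] -/
theorem driftStretchSilencingCost_false_without_equation :
    ¬ ∀ B γ δ Γ₂ : ℝ, 1 ≤ B → 0 < γ → 0 < δ → 1 ≤ Γ₂ → ∃ K c : ℝ, Γ₂ ≤ K ∧ 0 < c ∧ c ≤ δ ∧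
      ∀ (ω v : ℝ → (EuclideanSpace ℝ (Fin 3)) → (EuclideanSpace ℝ (Fin 3))) (y : EuclideanSpace ℝ (Fin 3))
        (σ t t₁ : ℝ), 0 < σ → t < t₁ → t₁ ≤ t + σ ^ 2 →
        (IsSmoothSpaceTimeOn (Icc t t₁) ω ∧ IsSmoothSpaceTimeOn (Icc t t₁) v ∧
          ∀ s ∈ Icc t t₁, ∀ x ∈ ball y (2 * K * σ),
            (∀ j : ℕ, j ≤ 5 → ‖iteratedFDeriv ℝ j (ω s) x‖ ≤ B * σ ^ (-((j : ℝ) + 2))) ∧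
            (∀ j : ℕ, j ≤ 4 → ‖iteratedFDeriv ℝ j (v s) x‖ ≤ B * σ ^ (-((j : ℝ) + 1))) ∧
            (∀ s' ∈ Icc t t₁, ‖v s x - v s' x‖ ≤ B * σ ^ (-(1 : ℝ)) * (|s - s'| / σ ^ 2) ^ γ ∧
              ‖fderiv ℝ (v s) x - fderiv ℝ (v s') x‖ ≤ B * σ ^ (-(2 : ℝ)) * (|s - s'| / σ ^ 2) ^ γ ∧
              ‖iteratedFDeriv ℝ 2 (v s) x - iteratedFDeriv ℝ 2 (v s') x‖ ≤
                B * σ ^ (-(3 : ℝ)) * (|s - s'| / σ ^ 2) ^ γ)) →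
        ENNReal.ofReal (δ / σ) ≤ ∫⁻ x in ball y (Γ₂ * σ), ‖ω t x‖ₑ ^ 2 →
        ENNReal.ofReal (c / σ) ≤ ∫⁻ x in ball y (K * σ), ‖ω t₁ x‖ₑ ^ 2 := by
  intro h
  obtain ⟨K, c, hK, hc, -, H⟩ := h 1 1 1 1 le_rfl one_pos one_pos le_rfl
  set e : EuclideanSpace ℝ (Fin 3) := EuclideanSpace.single (0 : Fin 3) (1 : ℝ) with he_def
  have he : ‖e‖ = 1 := by simp [he_def]
  set ω : ℝ → EuclideanSpace ℝ (Fin 3) → EuclideanSpace ℝ (Fin 3) := fun s _ => (1 - s) • e with hω_def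
  set v : ℝ → EuclideanSpace ℝ (Fin 3) → EuclideanSpace ℝ (Fin 3) := fun _ _ => 0 with hv_def
  have key := H ω v 0 1 0 1 one_pos one_pos (by norm_num) ⟨?_, ?_, ?_⟩ ?_
  · -- final enstrophy vanishes
    have h0 : ∫⁻ x in ball (0 : EuclideanSpace ℝ (Fin 3)) (K * 1), ‖ω 1 x‖ₑ ^ 2 = 0 := by
      rw [lintegral_ball_of_norm_const (ω 1) 0 le_rfl (fun x => by simp [hω_def]) 0 (K * 1) (by linarith)]
      simp
    rw [h0, div_one] at key
    exact absurd key (not_le.2 (ENNReal.ofReal_pos.2 hc))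
  · -- joint smoothness of `ω`
    change ContDiffOn ℝ _ (uncurry ω) _
    exact ((contDiff_const.sub contDiff_fst).smul contDiff_const).contDiffOn
  · -- joint smoothness of `v = 0`
    change ContDiffOn ℝ _ (uncurry v) _
    exact contDiff_const.contDiffOn
  · intro s hs x _
    refine ⟨fun j _ => ?_, (zero_coefficient_clauses (B := 1) (γ := 1) zero_le_one one_pos (Icc 0 1) s x).1,
      (zero_coefficient_clauses (B := 1) (γ := 1) zero_le_one one_pos (Icc 0 1) s x).2⟩
    calc ‖iteratedFDeriv ℝ j (ω s) x‖ ≤ ‖(1 - s) • e‖ := norm_iteratedFDeriv_const_le j _ x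
      _ ≤ 1 := by
          rw [norm_smul, he, mul_one, Real.norm_eq_abs, abs_le]; constructor <;> linarith [hs.1, hs.2]
      _ = 1 * (1 : ℝ) ^ (-((j : ℝ) + 2)) := by rw [Real.one_rpow, mul_one]
  · -- initial centre enstrophy `4π/3 ≥ 1`
    rw [lintegral_ball_of_norm_const (ω 0) 1 zero_le_one (fun x => by simp [hω_def, he]) 0 (1 * 1)
      (by norm_num)]
    refine ENNReal.ofReal_le_ofReal ?_
    nlinarith [Real.pi_gt_three]

/-! ## (ω) The `j ≥ 1` vorticity bounds are load-bearing -/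

/-- **Sc″ needs the derivative bounds on `ω`.**  Keeping of clause (ω) only `‖ω‖ ≤ Bσ⁻²` (with (v), (m), (e)
intact) the silencing cost fails: the caloric shear mode `σ⁻²e^{−s}·abc 0 1 0`, `v = 0`, at the burn-out scale
`σ² = 5K³/c + 1` (p709605 `exists_burnout_scale`), `B = γ = δ = Γ₂ = 1`. [folklore] -/
theorem driftStretchSilencingCost_false_without_higherVorticityBounds :
    ¬ ∀ B γ δ Γ₂ : ℝ, 1 ≤ B → 0 < γ → 0 < δ → 1 ≤ Γ₂ → ∃ K c : ℝ, Γ₂ ≤ K ∧ 0 < c ∧ c ≤ δ ∧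
      ∀ (ω v : ℝ → (EuclideanSpace ℝ (Fin 3)) → (EuclideanSpace ℝ (Fin 3))) (y : EuclideanSpace ℝ (Fin 3))
        (σ t t₁ : ℝ), 0 < σ → t < t₁ → t₁ ≤ t + σ ^ 2 →
        (IsSmoothSpaceTimeOn (Icc t t₁) ω ∧ IsSmoothSpaceTimeOn (Icc t t₁) v ∧
          ∀ s ∈ Icc t t₁, ∀ x ∈ ball y (2 * K * σ),
            ‖ω s x‖ ≤ B * σ ^ (-(2 : ℝ)) ∧
            (∀ j : ℕ, j ≤ 4 → ‖iteratedFDeriv ℝ j (v s) x‖ ≤ B * σ ^ (-((j : ℝ) + 1))) ∧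
            (∀ s' ∈ Icc t t₁, ‖v s x - v s' x‖ ≤ B * σ ^ (-(1 : ℝ)) * (|s - s'| / σ ^ 2) ^ γ ∧
              ‖fderiv ℝ (v s) x - fderiv ℝ (v s') x‖ ≤ B * σ ^ (-(2 : ℝ)) * (|s - s'| / σ ^ 2) ^ γ ∧
              ‖iteratedFDeriv ℝ 2 (v s) x - iteratedFDeriv ℝ 2 (v s') x‖ ≤
                B * σ ^ (-(3 : ℝ)) * (|s - s'| / σ ^ 2) ^ γ) ∧
            timeDerivWithin (Icc t t₁) ω s x =
              (Δ (ω s)) x + fderiv ℝ (v s) x (ω s x) - fderiv ℝ (ω s) x (v s x)) →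
        ENNReal.ofReal (δ / σ) ≤ ∫⁻ x in ball y (Γ₂ * σ), ‖ω t x‖ₑ ^ 2 →
        ENNReal.ofReal (c / σ) ≤ ∫⁻ x in ball y (K * σ), ‖ω t₁ x‖ₑ ^ 2 := by
  intro h
  obtain ⟨K, c, hK, hc, -, H⟩ := h 1 1 1 1 le_rfl one_pos one_pos le_rfl
  obtain ⟨σ, hσ1, hini, hfin⟩ := exists_burnout_scale hK hc
  have hσ0 : 0 < σ := lt_of_lt_of_le one_pos hσ1
  have hK0 : 0 < K := lt_of_lt_of_le one_pos hK
  have hq0 : 0 < σ ^ (-(2 : ℝ)) := Real.rpow_pos_of_pos hσ0 _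
  set a : EuclideanSpace ℝ (Fin 3) → EuclideanSpace ℝ (Fin 3) := ABC.abc 0 1 0 with ha_def
  set ω : ℝ → EuclideanSpace ℝ (Fin 3) → EuclideanSpace ℝ (Fin 3) :=
    fun s x => (σ ^ (-(2 : ℝ)) * Real.exp (-s)) • a x with hω_def
  set v : ℝ → EuclideanSpace ℝ (Fin 3) → EuclideanSpace ℝ (Fin 3) := fun _ _ => 0 with hv_def
  have hnorm : ∀ s x, ‖ω s x‖ = σ ^ (-(2 : ℝ)) * Real.exp (-s) := by
    intro s x
    rw [hω_def]
    dsimp only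
    rw [norm_smul, ha_def, norm_abc_shear, mul_one, Real.norm_eq_abs,
      abs_of_pos (mul_pos hq0 (Real.exp_pos _))]
  have key := H ω v 0 σ 0 (σ ^ 2) hσ0 (by positivity) (by simp) ⟨?_, ?_, ?_⟩ ?_
  · -- final enstrophy `(σ⁻²e^{-σ²})²·(4π/3)(Kσ)³ < c/σ`
    rw [lintegral_ball_of_norm_const (ω (σ ^ 2)) _ (mul_pos hq0 (Real.exp_pos _)).le (hnorm _) 0 (K * σ)
      (by positivity)] at key
    exact absurd key (not_le.2 ((ENNReal.ofReal_lt_ofReal_iff (by positivity)).2 hfin))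
  · -- joint smoothness of `ω`
    change ContDiffOn ℝ _ (uncurry ω) _
    refine ContDiff.contDiffOn ?_
    have h1 : ContDiff ℝ ((⊤ : ℕ∞) : WithTop ℕ∞) fun p : ℝ × EuclideanSpace ℝ (Fin 3) =>
        σ ^ (-(2 : ℝ)) * Real.exp (-p.1) :=
      contDiff_const.mul (Real.contDiff_exp.comp contDiff_fst.neg)
    have h2 : ContDiff ℝ ((⊤ : ℕ∞) : WithTop ℕ∞) fun p : ℝ × EuclideanSpace ℝ (Fin 3) => a p.2 :=
      (ABC.contDiff_abc 0 1 0).comp contDiff_snd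
    exact h1.smul h2
  · -- joint smoothness of `v = 0`
    change ContDiffOn ℝ _ (uncurry v) _
    exact contDiff_const.contDiffOn
  · intro s hs x _
    refine ⟨?_, (zero_coefficient_clauses (B := 1) (γ := 1) zero_le_one hσ0 (Icc 0 (σ ^ 2)) s x).1,
      (zero_coefficient_clauses (B := 1) (γ := 1) zero_le_one hσ0 (Icc 0 (σ ^ 2)) s x).2, ?_⟩
    · rw [hnorm, one_mul]
      have : Real.exp (-s) ≤ 1 := Real.exp_le_one_iff.2 (by linarith [hs.1])
      nlinarith
    · have hσ2pos : (0 : ℝ) < σ ^ 2 := by positivity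
      have hderiv : timeDerivWithin (Icc 0 (σ ^ 2)) ω s x =
          (σ ^ (-(2 : ℝ)) * (Real.exp (-s) * -1)) • a x := by
        have hd : HasDerivAt (fun s' : ℝ => ω s' x)
            ((σ ^ (-(2 : ℝ)) * (Real.exp (-s) * -1)) • a x) s := by
          have := ((hasDerivAt_neg s).exp.const_mul (σ ^ (-(2 : ℝ)))).smul_const (a x)
          simpa [hω_def] using this
        rw [timeDerivWithin]
        exact hd.hasDerivWithinAt.derivWithin (uniqueDiffOn_Icc hσ2pos s hs)
      have hlap : (Δ (ω s)) x = (σ ^ (-(2 : ℝ)) * Real.exp (-s)) • (-a x) := by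
        have e1 : ω s = (σ ^ (-(2 : ℝ)) * Real.exp (-s)) • a := by
          funext z; rfl
        rw [e1, InnerProductSpace.laplacian_smul _ ((ABC.contDiff_abc 0 1 0).contDiffAt (n := 2)), ha_def,
          ABC.laplacian_abc]
      have hv0 : fderiv ℝ (v s) x = 0 := by
        change fderiv ℝ (fun _ : EuclideanSpace ℝ (Fin 3) => (0 : EuclideanSpace ℝ (Fin 3))) x = 0
        exact fderiv_const_apply 0
      have hvs : v s x = 0 := rfl
      rw [hderiv, hlap, hv0, hvs, zero_apply, map_zero, add_zero, sub_zero, smul_neg,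
        ← neg_smul]
      congr 1; ring
  · -- initial centre enstrophy `(σ⁻²)²·(4π/3)σ³ ≥ 1/σ`
    rw [lintegral_ball_of_norm_const (ω 0) (σ ^ (-(2 : ℝ))) hq0.le
      (fun x => by rw [hnorm, neg_zero, Real.exp_zero, mul_one]) 0 (1 * σ) (by positivity)]
    exact ENNReal.ofReal_le_ofReal hini

/-! ## (m) and the high derivative bounds are not needed given Sc′ -/

/-- **The flat class lies in the inequality class.**  `j ≤ 1` bounds on `ω` and `v` plus the equation give
Sc′'s pointwise clause with the same `B`. -/
theorem thickBox_clause_of_flat {B σ : ℝ} {ω v : ℝ → (EuclideanSpace ℝ (Fin 3)) → (EuclideanSpace ℝ (Fin 3))}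
    {S : Set ℝ} {s : ℝ} {x : EuclideanSpace ℝ (Fin 3)} (hB : 0 ≤ B) (hσ : 0 < σ)
    (hω0 : ‖ω s x‖ ≤ B * σ ^ (-(2 : ℝ))) (hω1 : ‖fderiv ℝ (ω s) x‖ ≤ B * σ ^ (-(3 : ℝ)))
    (hv0 : ‖v s x‖ ≤ B * σ ^ (-(1 : ℝ))) (hv1 : ‖fderiv ℝ (v s) x‖ ≤ B * σ ^ (-(2 : ℝ)))
    (heq : timeDerivWithin S ω s x = (Δ (ω s)) x + fderiv ℝ (v s) x (ω s x) - fderiv ℝ (ω s) x (v s x)) :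
    ‖ω s x‖ ≤ B * σ ^ (-(2 : ℝ)) ∧ ‖fderiv ℝ (ω s) x‖ ≤ B * σ ^ (-(3 : ℝ)) ∧
      ‖timeDerivWithin S ω s x - (Δ (ω s)) x‖ ≤
        B * σ ^ (-(2 : ℝ)) * ‖ω s x‖ + B * σ ^ (-(1 : ℝ)) * ‖fderiv ℝ (ω s) x‖ := by
  refine ⟨hω0, hω1, ?_⟩
  have hrew : timeDerivWithin S ω s x - (Δ (ω s)) x =
      fderiv ℝ (v s) x (ω s x) - fderiv ℝ (ω s) x (v s x) := by
    rw [heq]; abel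
  rw [hrew]
  have hBσ1 : 0 ≤ B * σ ^ (-(1 : ℝ)) := by positivity
  calc ‖fderiv ℝ (v s) x (ω s x) - fderiv ℝ (ω s) x (v s x)‖
      ≤ ‖fderiv ℝ (v s) x (ω s x)‖ + ‖fderiv ℝ (ω s) x (v s x)‖ := norm_sub_le _ _
    _ ≤ ‖fderiv ℝ (v s) x‖ * ‖ω s x‖ + ‖fderiv ℝ (ω s) x‖ * ‖v s x‖ :=
        add_le_add (ContinuousLinearMap.le_opNorm _ _) (ContinuousLinearMap.le_opNorm _ _)
    _ ≤ B * σ ^ (-(2 : ℝ)) * ‖ω s x‖ + ‖fderiv ℝ (ω s) x‖ * (B * σ ^ (-(1 : ℝ))) :=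
        add_le_add (mul_le_mul_of_nonneg_right hv1 (norm_nonneg _))
          (mul_le_mul_of_nonneg_left hv0 (norm_nonneg _))
    _ = B * σ ^ (-(2 : ℝ)) * ‖ω s x‖ + B * σ ^ (-(1 : ℝ)) * ‖fderiv ℝ (ω s) x‖ := by ring

/-- **Sc′ ⇒ the FLAT silencing cost** (drift–stretch class with only `j ≤ 1` bounds on `ω`, `v`, no moduli, no
`γ`; same `K`, `c`). -/
theorem driftStretchSilencingCostFlat_of_thickBoxSilencingCost (h : ThickBoxSilencingCost) :
    ∀ B δ Γ₂ : ℝ, 1 ≤ B → 0 < δ → 1 ≤ Γ₂ → ∃ K c : ℝ, Γ₂ ≤ K ∧ 0 < c ∧ c ≤ δ ∧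
      ∀ (ω v : ℝ → (EuclideanSpace ℝ (Fin 3)) → (EuclideanSpace ℝ (Fin 3))) (y : EuclideanSpace ℝ (Fin 3))
        (σ t t₁ : ℝ), 0 < σ → t < t₁ → t₁ ≤ t + σ ^ 2 →
        IsSmoothSpaceTimeOn (Icc t t₁) ω →
        (∀ s ∈ Icc t t₁, ∀ x ∈ ball y (2 * K * σ),
            ‖ω s x‖ ≤ B * σ ^ (-(2 : ℝ)) ∧ ‖fderiv ℝ (ω s) x‖ ≤ B * σ ^ (-(3 : ℝ)) ∧
            ‖v s x‖ ≤ B * σ ^ (-(1 : ℝ)) ∧ ‖fderiv ℝ (v s) x‖ ≤ B * σ ^ (-(2 : ℝ)) ∧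
            timeDerivWithin (Icc t t₁) ω s x =
              (Δ (ω s)) x + fderiv ℝ (v s) x (ω s x) - fderiv ℝ (ω s) x (v s x)) →
        ENNReal.ofReal (δ / σ) ≤ ∫⁻ x in ball y (Γ₂ * σ), ‖ω t x‖ₑ ^ 2 →
        ENNReal.ofReal (c / σ) ≤ ∫⁻ x in ball y (K * σ), ‖ω t₁ x‖ₑ ^ 2 := by
  intro B δ Γ₂ hB hδ hΓ₂
  obtain ⟨K, c, hK, hc, hcδ, H⟩ := h B δ Γ₂ hB hδ hΓ₂
  refine ⟨K, c, hK, hc, hcδ, fun ω v y σ t t₁ hσ htt₁ ht₁ hsm hflat hinit => ?_⟩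
  refine H ω y σ t t₁ hσ htt₁ ht₁ hsm (fun s hs x hx => ?_) hinit
  obtain ⟨hω0, hω1, hv0, hv1, heq⟩ := hflat s hs x hx
  exact thickBox_clause_of_flat (by linarith) hσ hω0 hω1 hv0 hv1 heq

/-- **The flat silencing cost implies Sc″** (for every `γ`): the drift–stretch class is inside the flat class. -/
theorem driftStretchSilencingCost_of_flat
    (h : ∀ B δ Γ₂ : ℝ, 1 ≤ B → 0 < δ → 1 ≤ Γ₂ → ∃ K c : ℝ, Γ₂ ≤ K ∧ 0 < c ∧ c ≤ δ ∧
      ∀ (ω v : ℝ → (EuclideanSpace ℝ (Fin 3)) → (EuclideanSpace ℝ (Fin 3))) (y : EuclideanSpace ℝ (Fin 3))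
        (σ t t₁ : ℝ), 0 < σ → t < t₁ → t₁ ≤ t + σ ^ 2 →
        IsSmoothSpaceTimeOn (Icc t t₁) ω →
        (∀ s ∈ Icc t t₁, ∀ x ∈ ball y (2 * K * σ),
            ‖ω s x‖ ≤ B * σ ^ (-(2 : ℝ)) ∧ ‖fderiv ℝ (ω s) x‖ ≤ B * σ ^ (-(3 : ℝ)) ∧
            ‖v s x‖ ≤ B * σ ^ (-(1 : ℝ)) ∧ ‖fderiv ℝ (v s) x‖ ≤ B * σ ^ (-(2 : ℝ)) ∧
            timeDerivWithin (Icc t t₁) ω s x =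
              (Δ (ω s)) x + fderiv ℝ (v s) x (ω s x) - fderiv ℝ (ω s) x (v s x)) →
        ENNReal.ofReal (δ / σ) ≤ ∫⁻ x in ball y (Γ₂ * σ), ‖ω t x‖ₑ ^ 2 →
        ENNReal.ofReal (c / σ) ≤ ∫⁻ x in ball y (K * σ), ‖ω t₁ x‖ₑ ^ 2) :
    DriftStretchSilencingCost := by
  intro B γ δ Γ₂ hB _hγ hδ hΓ₂
  obtain ⟨K, c, hK, hc, hcδ, H⟩ := h B δ Γ₂ hB hδ hΓ₂
  refine ⟨K, c, hK, hc, hcδ, fun ω v y σ t t₁ hσ htt₁ ht₁ hbox hinit => ?_⟩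
  refine H ω v y σ t t₁ hσ htt₁ ht₁ hbox.1 (fun s hs x hx => ?_) hinit
  obtain ⟨hω, hv, -, heq⟩ := hbox.2.2 s hs x hx
  refine ⟨?_, ?_, ?_, ?_, heq⟩
  · have h0 := hω 0 (by norm_num)
    rw [norm_iteratedFDeriv_zero] at h0
    simpa using h0
  · have h1 := hω 1 (by norm_num)
    rw [norm_iteratedFDeriv_one, Nat.cast_one, show (-((1 : ℝ) + 2)) = -(3 : ℝ) by norm_num] at h1
    exact h1
  · have h0 := hv 0 (by norm_num)
    rw [norm_iteratedFDeriv_zero] at h0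
    simpa using h0
  · have h1 := hv 1 (by norm_num)
    rw [norm_iteratedFDeriv_one, Nat.cast_one, show (-((1 : ℝ) + 1)) = -(2 : ℝ) by norm_num] at h1
    exact h1

end

end Summit.NavierStokesRegularity.NavierStokesRegularity.Theorems.TypeIQuantSubcubicExp.Negative.SmoothSilence
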